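import Literature.MathematicalPhysics.QuantumFieldTheory.Balaban1983to89.B6SectADomainsV1
import Literature.MathematicalPhysics.QuantumFieldTheory.Balaban1983to89.B5Positivity172Lattice
import Literature.MathematicalPhysics.QuantumFieldTheory.BalabanImbrieJaffe1984to88.BIJ85CurlQsstar

/-!
# `Balaban1983to89.B6SectAZeroModesV1` — T. Bałaban, *Propagators and renormalization transformations for lattice gauge
# theories. II*, Commun. Math. Phys. **96** (1984) 223–250 [Balaban1984PropagatorsII], Sect. A pp. 225–226 ON THE V1
# MULTI-LEVEL TORUS CALCULUS: the ZERO MODES of the variational problem (2.5)–(2.7)/(2.12) — *"the Laplace operator Δ is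
# positive on the subspace N(Q′), hence it is invertible on this subspace"* (p. 225, the qualitative content of (2.11)) and
# the multi-level version of [Balaban1984PropagatorsI] p. 30 «∂A = 0, QA = 0 ⇒ A = ∂φ»: a curl-free bond field satisfying the
# homogeneous constraints (2.6) is a pure gauge `∂φ` with `φ ∈ N(Q′)`, hence vanishes under the gauge condition (2.12) — the
# kernel statement behind *"One of our main results will be that the operator Δ_a is bounded from below by a positive
# constant"* (p. 226)

statement-level skeleton of published theorems with citation tags; proofs where landed; nothing here is a claim about the
Yang–Mills mass gap

PDF held: `paper:balaban1984-cmp96-propagators-rt-ii` (journal page = PDF page + 222); pp. 224–228 read AS IMAGES on the ×2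
renders `run/shared/lean/pub/pub-balaban/b2b-balaban-ref1/pages/1984-cmp96-propagators-rt-II/…-p002…p006-x2.png` (this seat).

CITATION HEADER (lean-in-tree rule).  Cell `lit-balaban` (HOME `run/shared/lean/pub/lit-balaban/`), PHASE-2 proof seat **p21**
(gen 5), B6 fold owner r03, referee ref-4; file 2/3 of r03's ranked Phase-2 target P2 (see `…B6SectADomainsV1`, file 1, for the
data `Domains`, `Λ_j`, `N(Q′)` and Lemmas S/V).  WHAT IS REPRODUCED: SKELETON rows **B6.Eq2.11** (the sentence p. 225 *"the
Laplace operator Δ is positive on the subspace N(Q′), hence it is invertible on this subspace"* — its qualitative content, on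
the concrete multi-level `N(Q′)`; the quantitative (2.11) is r03's `…B6Eq211`, printed π² refuted/repaired there), **B6.Eq2.19/
B6.Eq2.21** (the kernel statement that makes `Δ_a` (2.19) positive definite, used by file 3 `…B6SectAVectorModelV1`).  Inputs
BY NAME: p11's `…B5Positivity172Lattice` ([Balaban1984PropagatorsI] p. 22/25/30 on the V1 calculus: `eq_zero_of_laplace_eq_zero`,
`exists_grad_of_curl_eq_zero_of_bondAvgIter_eq_zero`), applied AT THE TOP LEVEL `k` where Lemmas S/V of file 1 make the
one-level hypotheses `Q′_kλ ≡ 0`, `Q_kA ≡ 0` available, plus a DESCENT through the levels proved here; p27's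
`…BIJ85CurlQsstar.shift_blockSite_of_lt` and p08's `…BIJ85GaugeFunction5113.exists_blockSite_eq` (block bookkeeping).

PRINT (pp. 224–226, verbatim; the functional (2.5), the constraints (2.6), the gauge group (2.7) are quoted in file 1).
p. 225: *"N(Q′) = {λ: λ satisfies (2.7)}, (2.10) and let R be an orthogonal projection in the space L²(T_η) onto the subspace
ΔN(Q′). Equation (2.9) implies Δλ₀ = R∂*A, and this equation has exactly one solution because the Laplace operator Δ is
positive on the subspace N(Q′), hence it is invertible on this subspace. More exactly we have the inequality (2.11) … Thus
the functional (2.8) has exactly one minimum on each orbit. This minimum satisfies the equation R∂*A^{λ₀} = 0, or R∂*A = 0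
if we take A^{λ₀} as A. (2.12)"*; p. 226: *"Now let us come back to the variational problem (2.5), (2.6) with the gauge fixing
condition (2.12). We will prove that there exists exactly one critical configuration, which is of course, a minimum of the
functional (2.5). … One of our main results will be that the operator Δ_a is bounded from below by a positive constant"*.

WHAT IS PROVED (0 sorry, 0 new named facts; axioms standard; real fields, lattice factor `c ≠ 0`, every nested family
`D : Domains P`).  §1 block connectivity: a function constant across the interior bonds of a block `B(y)` is constant on `B(y)`
(`eq_blockSite_zero_of_forall_shift`).  §2 the DESCENT step: if `Q′_{j+1}φ = 0` on the `(j+1)`-blocks not inside `Ω_{j+2}` and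
`Q′_jφ` has equal values at the two ends of every `j`-bond with both ends not inside `Ω_{j+1}`, then `Q′_jφ = 0` on the `j`-blocks
not inside `Ω_{j+1}` (`descend`).  §3 **the zero-mode theorem** `exists_inGauge_grad_of_curl_eq_zero`: `∂A = 0` and `Q_jA = 0 on
Λ_j ∀ j` ⇒ `A = ∂φ` with `φ ∈ N(Q′)` (top level: Lemma V gives `Q_kA ≡ 0`, p11 gives `A = ∂φ₀` with `Q′_kφ₀ ≡ 0`; Lemma V and
(1.20) give the bond hypothesis of §2 at every level; the descent gives `φ₀ ∈ N(Q′)`).  §4 **p. 225**: `λ ∈ N(Q′)`, `Δλ = 0 ⇒ λ = 0`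
(`eq_zero_of_inGauge_of_laplace_eq_zero`) and `Δ` is injective on `N(Q′)` (`laplace_injOn_gaugeSpace`).  §5 **the kernel of Δ_a**:
`∂A = 0`, `Q_jA = 0 on Λ_j ∀ j`, and `∂*A ⊥ ΔN(Q′)` (i.e. `R∂*A = 0`) ⇒ `A = 0` (`eq_zero_of_curl_constr_landau`) — on the V1
calculus the three terms of `⟨A, Δ_aA⟩ = ‖∂A‖² + ⟨∂*A, R∂*A⟩ + ⟨QA, aQA⟩` have no common zero but `A = 0`.
-/

namespace Literature.MathematicalPhysics.QuantumFieldTheory.Balaban1983to89.B6SectAZeroModesV1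

open LatticeFieldCalculus B5Eq118OneStroke B5Eq120IterProof B5AveragingLocalityV1 B6SectADomainsV1 B5Positivity172Lattice
open BalabanImbrieJaffe1984to88.BIJ85GaugeFunction5113 (siteAvgIter_add siteAvgIter_sub siteAvgIter_smul exists_blockSite_eq)
open BalabanImbrieJaffe1984to88.BIJ85CurlQsstar (shift_blockSite_of_lt)

noncomputable section

variable {P : Params} {j : ℕ}

/-! ## §1. Connectivity of a block: constant across interior bonds ⇒ constant on `B(y)` -/

/-- the offset `0 ∈ {0,…,L−1}^d` (the lowest-label corner of a block). [cite: Balaban1984PropagatorsI, (1.6) p.18] -/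
def zeroOff (P : Params) : Fin P.d → Fin P.L := fun _ => ⟨0, P.L_pos⟩

/-- A function on the block `B(y)` that does not change across any interior bond `⟨x, x + e_μ⟩` of the block (`x = blockSite y r`,
`r_μ + 1 < L`) takes at every site of the block its value at the corner `blockSite y 0` (induction on the total offset `Σ_μ r_μ`).
[cite: Balaban1984PropagatorsI, (1.6) p.18] -/
theorem eq_blockSite_zero_of_forall_shift {V : Type*} (f : Site P j → V) (y : Site P (j + 1))
    (h : ∀ (r : Fin P.d → Fin P.L) (μ : Fin P.d) (hr : (r μ : ℕ) + 1 < P.L),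
      f (Site.blockSite y (Function.update r μ ⟨r μ + 1, hr⟩)) = f (Site.blockSite y r)) :
    ∀ r : Fin P.d → Fin P.L, f (Site.blockSite y r) = f (Site.blockSite y (zeroOff P)) := by
  suffices H : ∀ (s : ℕ) (r : Fin P.d → Fin P.L), ∑ μ, (r μ : ℕ) = s →
      f (Site.blockSite y r) = f (Site.blockSite y (zeroOff P)) from fun r => H _ r rfl
  intro s
  induction s using Nat.strong_induction_on with
  | _ s ih =>
    intro r hs
    by_cases h0 : ∀ μ, (r μ : ℕ) = 0
    · have : r = zeroOff P := funext fun μ => Fin.ext (h0 μ)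
      rw [this]
    · obtain ⟨μ, hμ⟩ := not_forall.mp h0
      have hμ' : 0 < (r μ : ℕ) := Nat.pos_of_ne_zero hμ
      set r' : Fin P.d → Fin P.L := Function.update r μ ⟨(r μ : ℕ) - 1, by have := (r μ).isLt; omega⟩ with hr'
      have hr'μ : (r' μ : ℕ) = (r μ : ℕ) - 1 := by simp [hr']
      have hlt : (r' μ : ℕ) + 1 < P.L := by have := (r μ).isLt; omega
      have hupd : Function.update r' μ ⟨r' μ + 1, hlt⟩ = r := by
        funext ν
        by_cases hν : ν = μ
        · subst hν
          rw [Function.update_self]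
          exact Fin.ext (by simp only [hr'μ]; omega)
        · rw [Function.update_of_ne hν, hr', Function.update_of_ne hν]
      have hstep := h r' μ hlt
      rw [hupd] at hstep
      rw [hstep]
      refine ih (∑ ν, (r' ν : ℕ)) ?_ r' rfl
      rw [← hs]
      refine Finset.sum_lt_sum (fun ν _ => ?_) ⟨μ, Finset.mem_univ _, by omega⟩
      by_cases hν : ν = μ
      · subst hν; omega
      · rw [hr', Function.update_of_ne hν]

/-! ## §2. The descent step from level `j+1` to level `j` -/

variable (D : Domains P)

/-- a `j`-block not inside `Ω_{j+1}` has its `(j+1)`-block not inside `Ω_{j+2}` (nesting (2.1)). [cite: Balaban1984PropagatorsII, (2.1) p.224] -/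
theorem not_deep_blockOf {j : ℕ} {y : Site P j} (hy : ¬ D.Deep j y) : ¬ D.Deep (j + 1) (blockOf y) :=
  fun h => hy (D.nested _ h)

/-- **Descent.**  Let `ψ_j := Q′_jφ`.  If `ψ_{j+1} = 0` on the `(j+1)`-blocks not inside `Ω_{j+2}`, and `ψ_j` takes equal
values at the two ends of every `j`-bond whose ends are not inside `Ω_{j+1}`, then `ψ_j = 0` on the `j`-blocks not inside
`Ω_{j+1}`: such a block `y` lies in a `(j+1)`-block `Y` not inside `Ω_{j+1}`, all of whose sub-blocks are joined by bonds of
the second kind, so `ψ_j` is constant on `B(Y)` with mean `ψ_{j+1}(Y) = 0` (standing range `j + 1 ≤ m + K`).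
[cite: Balaban1984PropagatorsII, (2.7) p.224 + (2.10) p.225] -/
theorem descend {φ : SiteField P 0 ℝ} {j : ℕ} (hj : j + 1 ≤ P.m + P.K)
    (hup : ∀ Y : Site P (j + 1), ¬ D.Deep (j + 1) Y → siteAvgIter (j + 1) φ Y = 0)
    (hflat : ∀ b : PBond P j, ¬ D.Deep j b.src → ¬ D.Deep j b.tgt → siteAvgIter j φ b.tgt = siteAvgIter j φ b.src)
    (y : Site P j) (hy : ¬ D.Deep j y) : siteAvgIter j φ y = 0 := by
  obtain ⟨r₀, hr₀⟩ := exists_blockSite_eq hj y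
  have hYnd : ¬ D.Deep (j + 1) (blockOf y) := not_deep_blockOf D hy
  -- `Q′_jφ` is constant on `B(blockOf y)`
  have hnd : ∀ r : Fin P.d → Fin P.L, ¬ D.Deep j (Site.blockSite (blockOf y) r) := fun r => by
    simpa [Domains.Deep, Site.blockOf_blockSite hj] using (show blockOf y ∉ D.Om (j + 1) from hy)
  have hconst : ∀ r, siteAvgIter j φ (Site.blockSite (blockOf y) r) = siteAvgIter j φ (Site.blockSite (blockOf y) (zeroOff P)) :=
    eq_blockSite_zero_of_forall_shift (siteAvgIter j φ) (blockOf y) fun r μ hr => by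
      have h := hflat ⟨Site.blockSite (blockOf y) r, μ⟩ (hnd r) (by
        show ¬ D.Deep j ((Site.blockSite (blockOf y) r).shift μ)
        rw [shift_blockSite_of_lt (blockOf y) r μ hr]; exact hnd _)
      simpa [PBond.tgt, shift_blockSite_of_lt (blockOf y) r μ hr] using h
  -- its block mean vanishes
  have hmean : siteAvg (siteAvgIter j φ) (blockOf y) = 0 := by rw [← siteAvgIter_succ]; exact hup _ hYnd
  have hL : ((P.L : ℝ) ^ P.d) ≠ 0 := pow_ne_zero _ (Nat.cast_ne_zero.mpr P.L_pos.ne')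
  have hsum : ∑ r : Fin P.d → Fin P.L, siteAvgIter j φ (Site.blockSite (blockOf y) r)
      = (P.L : ℝ) ^ P.d * siteAvgIter j φ (Site.blockSite (blockOf y) (zeroOff P)) := by
    rw [Finset.sum_congr rfl fun r _ => hconst r, Finset.sum_const, Finset.card_univ, Fintype.card_fun, Fintype.card_fin,
      Fintype.card_fin, nsmul_eq_mul, Nat.cast_pow]
  have hzero : siteAvgIter j φ (Site.blockSite (blockOf y) (zeroOff P)) = 0 := by
    unfold siteAvg at hmean
    rw [hsum, smul_eq_mul, ← mul_assoc, inv_mul_cancel₀ hL, one_mul] at hmean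
    exact hmean
  rw [← hr₀, hconst r₀, hzero]

/-- The descent iterated from the top: if `Q′_kφ ≡ 0` on `T^{(k)}` and, at every level `j ≤ k`, `Q′_jφ` takes equal values at
the ends of every `j`-bond with both ends not inside `Ω_{j+1}`, then `φ ∈ N(Q′)` (indeed `Q′_jφ = 0` on every `j`-block not
inside `Ω_{j+1}`). [cite: Balaban1984PropagatorsII, (2.7) p.224 + (2.10) p.225] -/
theorem inGauge_of_top_of_flat {φ : SiteField P 0 ℝ} (htop : siteAvgIter D.k φ = 0)
    (hflat : ∀ j ≤ D.k, ∀ b : PBond P j, ¬ D.Deep j b.src → ¬ D.Deep j b.tgt →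
      siteAvgIter j φ b.tgt = siteAvgIter j φ b.src) :
    D.InGauge φ := by
  have hC : ∀ (i j : ℕ), j + i = D.k → ∀ y : Site P j, ¬ D.Deep j y → siteAvgIter j φ y = 0 := by
    intro i
    induction i with
    | zero =>
      intro j hj y _
      rw [Nat.add_zero] at hj
      subst hj
      exact congrFun htop y
    | succ i ih =>
      intro j hj y hy
      have hjk : j + 1 ≤ D.k := by omega
      exact descend D (hjk.trans D.hk) (ih (j + 1) (by omega)) (hflat j (by omega)) y hy
  intro j y hy
  exact hC (D.k - j) j (Nat.add_sub_cancel' (D.le_of_lamSite hy)) y hy.2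

/-! ## §3. The zero-mode theorem: `∂A = 0` and `QA = 0` force `A = ∂φ`, `φ ∈ N(Q′)` -/

/-- (1.20) on a bond with both ends not inside `Ω_{j+1}` when `Q_jA = 0` there: for `A = ∂φ`, `Q′_jφ` takes equal values at
the two ends. [cite: Balaban1984PropagatorsII, (2.7) p.224] -/
theorem siteAvgIter_tgt_eq_src_of_grad {c : ℝ} (hc : c ≠ 0) {φ : SiteField P 0 ℝ} {j : ℕ} (hj : j ≤ P.m + P.K)
    (b : PBond P j) (hb : bondAvgIter j (grad c φ) b = 0) : siteAvgIter j φ b.tgt = siteAvgIter j φ b.src := by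
  have hL : ((P.L : ℝ) ^ j) ≠ 0 := pow_ne_zero _ (Nat.cast_ne_zero.mpr P.L_pos.ne')
  simp only [bondAvgIter_grad j hj, grad, smul_eq_mul, mul_eq_zero] at hb
  rcases hb with hb | hb
  · exact absurd hb (div_ne_zero hc hL)
  · linarith

/-- **The zero-mode theorem** (the multi-level version of [Balaban1984PropagatorsI] p. 30 *"QA = ∂₁ω + A₀ = 0 … implies ω = 0
… A₀ = 0, so A = 0"*): on the V1 calculus, for every nested family of domains, a bond field `A` on `T_η` with `∂A = 0` (lattice
factor `c ≠ 0`) satisfying the homogeneous constraints `Q_jA = 0 on Λ_j`, `j = 0, …, k` ((2.6) with `B = 0`) is a pure gauge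
`A = ∂φ` with `φ ∈ N(Q′)` ((2.7)).  Proof: Lemma V gives `Q_kA ≡ 0`, so `A = ∂φ₀` with `Q′_kφ₀ ≡ 0` (p11, torus windings);
Lemma V and (1.20) make `Q′_jφ₀` flat across the admissible `j`-bonds; the descent gives `φ₀ ∈ N(Q′)`.
[cite: Balaban1984PropagatorsII, (2.5)–(2.7) p.224 + (2.21) p.226] -/
theorem exists_inGauge_grad_of_curl_eq_zero {c : ℝ} (hc : c ≠ 0) {A : VecField P 0 ℝ} (hcurl : curl c A = 0)
    (hA : ∀ (j : ℕ) (b : PBond P j), D.LamBond j b → bondAvgIter j A b = 0) :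
    ∃ φ : SiteField P 0 ℝ, D.InGauge φ ∧ A = grad c φ := by
  have htop : bondAvgIter D.k A = 0 := D.bondAvgIter_top_eq_zero_of_constr_zero hA
  obtain ⟨φ, hφk, hAφ⟩ := exists_grad_of_curl_eq_zero_of_bondAvgIter_eq_zero D.hk hc hcurl htop
  refine ⟨φ, inGauge_of_top_of_flat D hφk fun j hj b hs ht => ?_, hAφ⟩
  refine siteAvgIter_tgt_eq_src_of_grad hc (hj.trans D.hk) b ?_
  rw [← hAφ]
  exact D.bondAvgIter_eq_zero_of_constr_zero hA j b hs ht

/-! ## §4. p. 225: *"the Laplace operator Δ is positive on the subspace N(Q′), hence it is invertible on this subspace"* -/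

/-- **p. 225, qualitative content of (2.11), PROVED on the V1 calculus** for the multi-level `N(Q′)` of every nested family:
`λ ∈ N(Q′)` and `Δλ = 0` (lattice factor `c ≠ 0`) force `λ = 0` (Lemma S gives `Q′_kλ ≡ 0`, then p11's one-level
`eq_zero_of_laplace_eq_zero`: `Δλ = 0` makes `λ` constant on the torus, and a constant with vanishing `k`-fold average is `0`).
[cite: Balaban1984PropagatorsII, (2.11) p.225] -/
theorem eq_zero_of_inGauge_of_laplace_eq_zero {c : ℝ} (hc : c ≠ 0) {lam : SiteField P 0 ℝ} (hlam : D.InGauge lam)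
    (hΔ : laplace c lam = 0) : lam = 0 :=
  eq_zero_of_laplace_eq_zero hc D.k (D.siteAvgIter_top_eq_zero_of_inGauge hlam) hΔ

/-- *"hence it is invertible on this subspace"*: `Δ` is injective on `N(Q′)` (so `Δλ₀ = R∂*A` has at most one solution
`λ₀ ∈ N(Q′)`, and exactly one once `R` projects onto `ΔN(Q′)` — file 3). [cite: Balaban1984PropagatorsII, (2.11)–(2.12) p.225] -/
theorem laplace_injOn_gaugeSpace {c : ℝ} (hc : c ≠ 0) :
    Set.InjOn (laplace c : SiteField P 0 ℝ → SiteField P 0 ℝ) D.gaugeSpace := by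
  intro f hf g hg hfg
  have hsub : laplace c (f - g) = 0 := by
    have : laplace c (f - g) = laplace c f - laplace c g := by
      rw [← diverg_grad, ← diverg_grad, ← diverg_grad, BalabanImbrieJaffe1984to88.BIJ85GaugeFunction5113.grad_sub]
      exact diverg_sub c (grad c f) (grad c g)
    rw [this, hfg, sub_self]
  exact sub_eq_zero.mp (eq_zero_of_inGauge_of_laplace_eq_zero D hc (D.gaugeSpace.sub_mem hf hg) hsub)

/-! ## §5. The kernel of `Δ_a`: curl-free + homogeneous constraints + the gauge condition (2.12) ⇒ `A = 0` -/

/-- **The kernel statement behind the positivity of `Δ_a` (2.19)** (p. 226 *"One of our main results will be that the operator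
Δ_a is bounded from below by a positive constant"*; p. 228 *"The only assumption we have used was the positivity of the operator
Δ_a"*), on the V1 calculus for every nested family: if `∂A = 0`, `Q_jA = 0 on Λ_j` for all `j`, and `∂*A ⊥ ΔN(Q′)` (the gauge
condition (2.12) `R∂*A = 0`, `R` = the orthogonal projection onto `ΔN(Q′)`), then `A = 0`.  Proof: `A = ∂φ`, `φ ∈ N(Q′)` (§3);
testing the orthogonality against `Δφ ∈ ΔN(Q′)` gives `‖Δφ‖² = ⟨∂*∂φ, Δφ⟩ = 0`, so `Δφ = 0`, so `φ = 0` (§4).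
[cite: Balaban1984PropagatorsII, (2.19)–(2.22) p.226] -/
theorem eq_zero_of_curl_constr_landau {c : ℝ} (hc : c ≠ 0) {A : VecField P 0 ℝ} (hcurl : curl c A = 0)
    (hA : ∀ (j : ℕ) (b : PBond P j), D.LamBond j b → bondAvgIter j A b = 0)
    (hR : ∀ μ : SiteField P 0 ℝ, D.InGauge μ → ∑ x, diverg c A x * laplace c μ x = 0) : A = 0 := by
  obtain ⟨φ, hφ, rfl⟩ := exists_inGauge_grad_of_curl_eq_zero D hc hcurl hA
  have h := hR φ hφ
  rw [diverg_grad] at h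
  have hΔ : laplace c φ = 0 := by
    funext x
    have hx := (Finset.sum_eq_zero_iff_of_nonneg fun x _ => mul_self_nonneg (laplace c φ x)).mp h x (Finset.mem_univ x)
    exact mul_self_eq_zero.mp hx
  rw [eq_zero_of_inGauge_of_laplace_eq_zero D hc hφ hΔ]
  exact BalabanImbrieJaffe1984to88.BIJ85GaugeFunction5113.grad_zero c

/-- The same with the gauge condition in its primitive form (2.8)/(2.12): `A` is a critical point of `λ ↦ ‖∂*A^λ‖²` over `N(Q′)`,
i.e. `Σ_x (∂*A)(x)(Δδλ)(x) = 0` for all `δλ ∈ N(Q′)` ((2.9) with `λ₀ = 0`). [cite: Balaban1984PropagatorsII, (2.8)–(2.9) p.224] -/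
theorem eq_zero_of_curl_constr_eq29 {c : ℝ} (hc : c ≠ 0) {A : VecField P 0 ℝ} (hcurl : curl c A = 0)
    (hA : ∀ (j : ℕ) (b : PBond P j), D.LamBond j b → bondAvgIter j A b = 0)
    (h29 : ∀ μ : SiteField P 0 ℝ, D.InGauge μ → ∑ x, laplace c μ x * diverg c A x = 0) : A = 0 :=
  eq_zero_of_curl_constr_landau D hc hcurl hA fun μ hμ => by simpa [mul_comm] using h29 μ hμ

end

end Literature.MathematicalPhysics.QuantumFieldTheory.Balaban1983to89.B6SectAZeroModesV1
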